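import Summits.Ventures.CertifiedManyBodySolver.Downfold.PressureAxisEOSDecide
import HarnessLib

/-!
# The EOS leg for the Vinet and Birch–Murnaghan laws of record: certified spacing from lit-3's
# modulus brackets, in VOLUME language (no inverse-law derivative needed)

Venture CertifiedManyBodySolver, cell `pub/hubbard-downfold` (S1 = downfolding front end = ROUTER),
seat hubbard-downfold-mod-2; namespace `Summit.Ventures.CertifiedManyBodySolver.Downfold.Inflation`.
Third part of KERNEL V. Most EOS of record in REFVALS-3 §5 are VINET or third-order BIRCH–MURNAGHAN
fits, whose inverse laws `vinetVolume` / `birchMurnaghan3Volume` (lit-3, `IsothermalEquationsOfState`)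
are defined as roots and carry no derivative in the tree. None is needed: lit-3 proved the MODULUS
BRACKETS along the forward laws, `B₀ + (2/3)·P(v) ≤ K(v) ≤ B₀ + B₀'·P(v)` (Vinet, `B₀' ≥ 1`) and
`B₀ + (7/3)·P(v) ≤ K(v) ≤ B₀ + B₀'·P(v)` (BM3, `B₀' ≥ 4`), and §1 integrates `K = -v dP/dv` between
two volumes (lit-3's comparison principle re-referenced at an arbitrary volume; floor AND ceiling;
existential-derivative adaptor). §2 VINET / §3 BM3: for `0 ≤ P₁ ≤ P₂` the spacing `ln(V(P₁)/V(P₂))`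
lies in `[(P₂ - P₁)/(B₀ + B₀' P₂), (P₂ - P₁)/(B₀ + β P₁)]` with `β = 2/3` resp. `7/3`; the
log-compressions `vinetStrain` / `bm3Strain = ln(V₀/V(P))` are monotone; all-in-one margin decisions
`exp_lt_on_pressure_Icc_of_vinet_test` / `_of_bm3_test`. §4 ROWS OF RECORD: the R-dq pre-registration
V (0,10) on the Vinet class `K₀ 162, K′ 3.5` of the V row (`v_0_10_vinet_test`, 0.5923 < 0.6); the Pb reach 10 → 13.7 as a statement about the
box BM3 law itself (`pb_bm3_reach_spacing_le`: `ln(V(10)/V(13.7)) ≤ 0.06`, any `V₀ > 0`).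

Everything is PROVED. WHAT THIS IS NOT: a claim about any material; the `(B₀, B₀')` are the printed
[float] fit parameters of the rows, and a passing test certifies only «these inputs ⇒ the word on the
pressure sub-interval».
-/

open Set

namespace Summit.Ventures.CertifiedManyBodySolver.Downfold

namespace Inflation

open Literature.MathematicalPhysics.StatisticalMechanics

/-! ## §1 The shifted comparison principle (volume language) -/

/-- **COMPARISON PRINCIPLE between two volumes, modulus FLOOR**: a pressure–volume law `P` with
derivative `P'` on `[V₂, V₁]` (`0 < V₂ ≤ V₁`) and `K(v) = -v P'(v) ≥ K_min` there satisfies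
`K_min · ln(V₁/V₂) ≤ P(V₂) - P(V₁)` (the function `v ↦ P(v) + K_min ln v` is antitone).
[folklore] -/
theorem mul_log_div_le_sub_of_bulkModulus_ge {P P' : ℝ → ℝ} {V₁ V₂ Kmin : ℝ} (hV₂ : 0 < V₂)
    (h21 : V₂ ≤ V₁) (hderiv : ∀ v ∈ Icc V₂ V₁, HasDerivAt P (P' v) v)
    (hK : ∀ v ∈ Icc V₂ V₁, Kmin ≤ -v * P' v) : Kmin * Real.log (V₁ / V₂) ≤ P V₂ - P V₁ := by
  have hd : ∀ v ∈ Icc V₂ V₁,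
      HasDerivAt (fun w => P w + Kmin * Real.log w) (P' v + Kmin * v⁻¹) v := fun v hv =>
    (hderiv v hv).add ((Real.hasDerivAt_log (lt_of_lt_of_le hV₂ hv.1).ne').const_mul Kmin)
  have hφ : AntitoneOn (fun w => P w + Kmin * Real.log w) (Icc V₂ V₁) := by
    refine antitoneOn_of_deriv_nonpos (convex_Icc V₂ V₁) ?_ ?_ ?_
    · exact fun v hv => (hd v hv).continuousAt.continuousWithinAt
    · exact fun v hv => (hd v (interior_subset hv)).differentiableAt.differentiableWithinAt
    · intro v hv
      have hv' : v ∈ Icc V₂ V₁ := interior_subset hv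
      have hv0 : 0 < v := lt_of_lt_of_le hV₂ hv'.1
      rw [(hd v hv').deriv]
      have hKv := hK v hv'
      have heq : P' v + Kmin * v⁻¹ = (v * P' v + Kmin) / v := by field_simp
      rw [heq]
      exact div_nonpos_iff.mpr (Or.inr ⟨by linarith, hv0.le⟩)
  have h := hφ ⟨le_rfl, h21⟩ ⟨h21, le_rfl⟩ h21
  have hV₁ : 0 < V₁ := lt_of_lt_of_le hV₂ h21
  simp only at h
  rw [Real.log_div hV₁.ne' hV₂.ne']
  linarith

/-- **COMPARISON PRINCIPLE, modulus CEILING**: `K(v) = -v P'(v) ≤ K_max` on `[V₂, V₁]` ⇒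
`P(V₂) - P(V₁) ≤ K_max · ln(V₁/V₂)`. [folklore] -/
theorem sub_le_mul_log_div_of_bulkModulus_le {P P' : ℝ → ℝ} {V₁ V₂ Kmax : ℝ} (hV₂ : 0 < V₂)
    (h21 : V₂ ≤ V₁) (hderiv : ∀ v ∈ Icc V₂ V₁, HasDerivAt P (P' v) v)
    (hK : ∀ v ∈ Icc V₂ V₁, -v * P' v ≤ Kmax) : P V₂ - P V₁ ≤ Kmax * Real.log (V₁ / V₂) := by
  have hd : ∀ v ∈ Icc V₂ V₁,
      HasDerivAt (fun w => P w + Kmax * Real.log w) (P' v + Kmax * v⁻¹) v := fun v hv =>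
    (hderiv v hv).add ((Real.hasDerivAt_log (lt_of_lt_of_le hV₂ hv.1).ne').const_mul Kmax)
  have hφ : MonotoneOn (fun w => P w + Kmax * Real.log w) (Icc V₂ V₁) := by
    refine monotoneOn_of_deriv_nonneg (convex_Icc V₂ V₁) ?_ ?_ ?_
    · exact fun v hv => (hd v hv).continuousAt.continuousWithinAt
    · exact fun v hv => (hd v (interior_subset hv)).differentiableAt.differentiableWithinAt
    · intro v hv
      have hv' : v ∈ Icc V₂ V₁ := interior_subset hv
      have hv0 : 0 < v := lt_of_lt_of_le hV₂ hv'.1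
      rw [(hd v hv').deriv]
      have hKv := hK v hv'
      have heq : P' v + Kmax * v⁻¹ = (v * P' v + Kmax) / v := by field_simp
      rw [heq]
      exact div_nonneg (by linarith) hv0.le
  have h := hφ ⟨le_rfl, h21⟩ ⟨h21, le_rfl⟩ h21
  have hV₁ : 0 < V₁ := lt_of_lt_of_le hV₂ h21
  simp only at h
  rw [Real.log_div hV₁.ne' hV₂.ne']
  linarith

/-- Floor, compressibility form: `K_min > 0` ⇒ `ln(V₁/V₂) ≤ (P(V₂) - P(V₁))/K_min`. [folklore] -/
theorem log_div_le_sub_div_of_bulkModulus_ge {P P' : ℝ → ℝ} {V₁ V₂ Kmin : ℝ} (hV₂ : 0 < V₂)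
    (h21 : V₂ ≤ V₁) (hKmin : 0 < Kmin) (hderiv : ∀ v ∈ Icc V₂ V₁, HasDerivAt P (P' v) v)
    (hK : ∀ v ∈ Icc V₂ V₁, Kmin ≤ -v * P' v) : Real.log (V₁ / V₂) ≤ (P V₂ - P V₁) / Kmin := by
  rw [le_div_iff₀ hKmin, mul_comm]
  exact mul_log_div_le_sub_of_bulkModulus_ge hV₂ h21 hderiv hK

/-- Compressibility form of the ceiling: `K_max > 0` ⇒ `(P(V₂) - P(V₁))/K_max ≤ ln(V₁/V₂)`. [folklore] -/
theorem sub_div_le_log_div_of_bulkModulus_le {P P' : ℝ → ℝ} {V₁ V₂ Kmax : ℝ} (hV₂ : 0 < V₂)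
    (h21 : V₂ ≤ V₁) (hKmax : 0 < Kmax) (hderiv : ∀ v ∈ Icc V₂ V₁, HasDerivAt P (P' v) v)
    (hK : ∀ v ∈ Icc V₂ V₁, -v * P' v ≤ Kmax) : (P V₂ - P V₁) / Kmax ≤ Real.log (V₁ / V₂) := by
  rw [div_le_iff₀ hKmax, mul_comm]
  exact sub_le_mul_log_div_of_bulkModulus_le hV₂ h21 hderiv hK

/-- Adaptor for lit-3's EXISTENTIAL modulus statements (`∃ P', HasDerivAt P P' v ∧ bound`): they
yield the functional hypotheses with `P' = deriv P`. [folklore] -/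
theorem hasDerivAt_deriv_and_of_exists {P : ℝ → ℝ} {v : ℝ} {Q : ℝ → Prop}
    (h : ∃ P' : ℝ, HasDerivAt P P' v ∧ Q P') : HasDerivAt P (deriv P v) v ∧ Q (deriv P v) := by
  obtain ⟨P', hP', hQ⟩ := h
  rw [hP'.deriv]
  exact ⟨hP', hQ⟩

/-! ## §2 The Vinet law of record -/

/-- The log-compression along the inverse Vinet law, `ln(V₀/V(P))`. [folklore] -/
noncomputable def vinetStrain (V₀ B₀ B₀' P : ℝ) : ℝ := Real.log (V₀ / vinetVolume V₀ B₀ B₀' P)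

/-- **VINET SPACING, upper bound**: for `V₀ > 0`, `B₀ > 0`, `B₀' ≥ 1`, `0 ≤ P₁ ≤ P₂`,
`ln(V(P₁)/V(P₂)) ≤ (P₂ - P₁)/(B₀ + (2/3) P₁)` — the modulus floor `B₀ + (2/3)·P(v) ≥ B₀ + (2/3) P₁` on
`[V(P₂), V(P₁)]` (lit-3 `vinet_le_bulkModulus`, `P` antitone) integrated by §1. [folklore] -/
theorem log_vinet_spacing_le {V₀ B₀ B₀' P₁ P₂ : ℝ} (hV₀ : 0 < V₀) (hB₀ : 0 < B₀) (hB : 1 ≤ B₀')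
    (hP₁ : 0 ≤ P₁) (h12 : P₁ ≤ P₂) :
    Real.log (vinetVolume V₀ B₀ B₀' P₁ / vinetVolume V₀ B₀ B₀' P₂) ≤ (P₂ - P₁) / (B₀ + 2 / 3 * P₁) := by
  set V₁ := vinetVolume V₀ B₀ B₀' P₁ with hV₁def
  set V₂ := vinetVolume V₀ B₀ B₀' P₂ with hV₂def
  have hP₂ : 0 ≤ P₂ := hP₁.trans h12
  have hV₂pos : 0 < V₂ := vinetVolume_pos hV₀ hB₀ hB hP₂
  have hV₁le : V₁ ≤ V₀ := vinetVolume_le_self hV₀.le hB₀ hB hP₁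
  have h21 : V₂ ≤ V₁ := vinetVolume_antitone_pressure hV₀.le hB₀ hB hP₁ h12
  have hPV₁ : vinetPressure V₀ B₀ B₀' V₁ = P₁ := vinetPressure_vinetVolume hV₀ hB₀ hB hP₁
  have hPV₂ : vinetPressure V₀ B₀ B₀' V₂ = P₂ := vinetPressure_vinetVolume hV₀ hB₀ hB hP₂
  have hKmin : 0 < B₀ + 2 / 3 * P₁ := by positivity
  have hanti := vinetPressure_strictAntiOn hV₀ hB₀ hB
  have key : Real.log (V₁ / V₂) ≤
      (vinetPressure V₀ B₀ B₀' V₂ - vinetPressure V₀ B₀ B₀' V₁) / (B₀ + 2 / 3 * P₁) := by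
    refine log_div_le_sub_div_of_bulkModulus_ge (P' := deriv (vinetPressure V₀ B₀ B₀')) hV₂pos h21
      hKmin (fun v hv => ?_) (fun v hv => ?_)
    · have hv0 : 0 < v := lt_of_lt_of_le hV₂pos hv.1
      exact (hasDerivAt_deriv_and_of_exists
        (vinet_le_bulkModulus hV₀ hB₀.le hB hv0 (hv.2.trans hV₁le))).1
    · have hv0 : 0 < v := lt_of_lt_of_le hV₂pos hv.1
      have hvV₀ : v ≤ V₀ := hv.2.trans hV₁le
      have hfl := (hasDerivAt_deriv_and_of_exists (vinet_le_bulkModulus hV₀ hB₀.le hB hv0 hvV₀)).2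
      -- `P(v) ≥ P(V₁) = P₁` for `v ≤ V₁` (antitone law)
      have hPv : P₁ ≤ vinetPressure V₀ B₀ B₀' v := by
        rw [← hPV₁]
        exact hanti.antitoneOn ⟨hv0, hvV₀⟩ ⟨lt_of_lt_of_le hV₂pos h21, hV₁le⟩ hv.2
      linarith
  rw [hPV₁, hPV₂] at key
  exact key

/-- **VINET SPACING, lower bound**: `(P₂ - P₁)/(B₀ + B₀' P₂) ≤ ln(V(P₁)/V(P₂))` — modulus ceiling
`B₀ + B₀' P(v) ≤ B₀ + B₀' P₂` on `[V(P₂), V(P₁)]` (lit-3 `vinet_bulkModulus_le`). [folklore] -/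
theorem le_log_vinet_spacing {V₀ B₀ B₀' P₁ P₂ : ℝ} (hV₀ : 0 < V₀) (hB₀ : 0 < B₀) (hB : 1 ≤ B₀')
    (hP₁ : 0 ≤ P₁) (h12 : P₁ ≤ P₂) :
    (P₂ - P₁) / (B₀ + B₀' * P₂) ≤ Real.log (vinetVolume V₀ B₀ B₀' P₁ / vinetVolume V₀ B₀ B₀' P₂) := by
  set V₁ := vinetVolume V₀ B₀ B₀' P₁ with hV₁def
  set V₂ := vinetVolume V₀ B₀ B₀' P₂ with hV₂def
  have hP₂ : 0 ≤ P₂ := hP₁.trans h12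
  have hB' : 0 < B₀' := by linarith
  have hV₂pos : 0 < V₂ := vinetVolume_pos hV₀ hB₀ hB hP₂
  have hV₁le : V₁ ≤ V₀ := vinetVolume_le_self hV₀.le hB₀ hB hP₁
  have hV₂le : V₂ ≤ V₀ := vinetVolume_le_self hV₀.le hB₀ hB hP₂
  have h21 : V₂ ≤ V₁ := vinetVolume_antitone_pressure hV₀.le hB₀ hB hP₁ h12
  have hPV₁ : vinetPressure V₀ B₀ B₀' V₁ = P₁ := vinetPressure_vinetVolume hV₀ hB₀ hB hP₁
  have hPV₂ : vinetPressure V₀ B₀ B₀' V₂ = P₂ := vinetPressure_vinetVolume hV₀ hB₀ hB hP₂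
  have hKmax : 0 < B₀ + B₀' * P₂ := by positivity
  have hanti := vinetPressure_strictAntiOn hV₀ hB₀ hB
  have key : (vinetPressure V₀ B₀ B₀' V₂ - vinetPressure V₀ B₀ B₀' V₁) / (B₀ + B₀' * P₂) ≤
      Real.log (V₁ / V₂) := by
    refine sub_div_le_log_div_of_bulkModulus_le (P' := deriv (vinetPressure V₀ B₀ B₀')) hV₂pos h21
      hKmax (fun v hv => ?_) (fun v hv => ?_)
    · have hv0 : 0 < v := lt_of_lt_of_le hV₂pos hv.1
      exact (hasDerivAt_deriv_and_of_exists
        (vinet_bulkModulus_le hV₀ hB₀.le hB hv0 (hv.2.trans hV₁le))).1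
    · have hv0 : 0 < v := lt_of_lt_of_le hV₂pos hv.1
      have hvV₀ : v ≤ V₀ := hv.2.trans hV₁le
      have hcl := (hasDerivAt_deriv_and_of_exists (vinet_bulkModulus_le hV₀ hB₀.le hB hv0 hvV₀)).2
      -- `P(v) ≤ P(V₂) = P₂` for `V₂ ≤ v` (antitone law)
      have hPv : vinetPressure V₀ B₀ B₀' v ≤ P₂ := by
        rw [← hPV₂]
        exact hanti.antitoneOn ⟨hV₂pos, hV₂le⟩ ⟨hv0, hvV₀⟩ hv.1
      nlinarith [mul_le_mul_of_nonneg_left hPv hB'.le]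
  rw [hPV₁, hPV₂] at key
  exact key

/-- The Vinet spacing is nonnegative (`0 ≤ P₁ ≤ P₂`). [folklore] -/
theorem log_vinet_spacing_nonneg {V₀ B₀ B₀' P₁ P₂ : ℝ} (hV₀ : 0 < V₀) (hB₀ : 0 < B₀) (hB : 1 ≤ B₀')
    (hP₁ : 0 ≤ P₁) (h12 : P₁ ≤ P₂) :
    0 ≤ Real.log (vinetVolume V₀ B₀ B₀' P₁ / vinetVolume V₀ B₀ B₀' P₂) := by
  have hB' : 0 < B₀' := by linarith
  have hK : 0 < B₀ + B₀' * P₂ := by nlinarith [hP₁.trans h12]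
  exact (div_nonneg (sub_nonneg.2 h12) hK.le).trans (le_log_vinet_spacing hV₀ hB₀ hB hP₁ h12)

/-- The spacing of the log-compression is the log of the volume ratio:
`vinetStrain P₂ - vinetStrain P₁ = ln(V(P₁)/V(P₂))`. [folklore] -/
theorem vinetStrain_sub_eq {V₀ B₀ B₀' P₁ P₂ : ℝ} (hV₀ : 0 < V₀) (hB₀ : 0 < B₀) (hB : 1 ≤ B₀')
    (hP₁ : 0 ≤ P₁) (hP₂ : 0 ≤ P₂) :
    vinetStrain V₀ B₀ B₀' P₂ - vinetStrain V₀ B₀ B₀' P₁ =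
      Real.log (vinetVolume V₀ B₀ B₀' P₁ / vinetVolume V₀ B₀ B₀' P₂) := by
  have h1 := vinetVolume_pos hV₀ hB₀ hB hP₁
  have h2 := vinetVolume_pos hV₀ hB₀ hB hP₂
  unfold vinetStrain
  rw [Real.log_div hV₀.ne' h2.ne', Real.log_div hV₀.ne' h1.ne', Real.log_div h1.ne' h2.ne']
  ring

/-- The Vinet log-compression is MONOTONE on `[P₁, P₂]` for `P₁ ≥ 0`. [folklore] -/
theorem vinetStrain_monotoneOn {V₀ B₀ B₀' P₁ P₂ : ℝ} (hV₀ : 0 < V₀) (hB₀ : 0 < B₀) (hB : 1 ≤ B₀')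
    (hP₁ : 0 ≤ P₁) : MonotoneOn (vinetStrain V₀ B₀ B₀') (Icc P₁ P₂) := by
  intro a ha b hb hab
  have ha0 : 0 ≤ a := hP₁.trans ha.1
  have hb0 : 0 ≤ b := hP₁.trans hb.1
  have h := log_vinet_spacing_nonneg hV₀ hB₀ hB ha0 hab
  rw [← vinetStrain_sub_eq hV₀ hB₀ hB ha0 hb0] at h
  linarith

/-- **VINET SPACING BOUND for the log-compression**: `c(P₂) - c(P₁) ≤ (P₂ - P₁)/(B₀ + (2/3) P₁)`.
[folklore] -/
theorem vinetStrain_sub_le {V₀ B₀ B₀' P₁ P₂ : ℝ} (hV₀ : 0 < V₀) (hB₀ : 0 < B₀) (hB : 1 ≤ B₀')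
    (hP₁ : 0 ≤ P₁) (h12 : P₁ ≤ P₂) :
    vinetStrain V₀ B₀ B₀' P₂ - vinetStrain V₀ B₀ B₀' P₁ ≤ (P₂ - P₁) / (B₀ + 2 / 3 * P₁) := by
  rw [vinetStrain_sub_eq hV₀ hB₀ hB hP₁ (hP₁.trans h12)]
  exact log_vinet_spacing_le hV₀ hB₀ hB hP₁ h12

/-- **ALL-IN-ONE, VINET EOS OF RECORD**: along the inverse Vinet law with printed `(V₀, B₀, B₀')`
(`B₀' ≥ 1`) the margin test run with `Lbar = (P₂ - P₁)/(B₀ + (2/3) P₁)` decides the upper guard on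
the whole pressure sub-interval `[P₁, P₂]`. [folklore] -/
theorem exp_lt_on_pressure_Icc_of_vinet_test {f f' : ℝ → ℝ} {V₀ B₀ B₀' P₁ P₂ S h₁ h₂ θ P : ℝ}
    (hV₀ : 0 < V₀) (hB₀ : 0 < B₀) (hB : 1 ≤ B₀') (hP₁ : 0 ≤ P₁) (h12 : P₁ ≤ P₂)
    (hcont : ContinuousOn f (Icc (vinetStrain V₀ B₀ B₀' P₁) (vinetStrain V₀ B₀ B₀' P₂)))
    (hder : ∀ x ∈ Ioo (vinetStrain V₀ B₀ B₀' P₁) (vinetStrain V₀ B₀ B₀' P₂), HasDerivAt f (f' x) x)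
    (hS : ∀ x ∈ Ioo (vinetStrain V₀ B₀ B₀' P₁) (vinetStrain V₀ B₀ B₀' P₂), |f' x| ≤ S)
    (hS0 : 0 ≤ S) (hx1 : S * (((P₂ - P₁) / (B₀ + 2 / 3 * P₁)) / 2) ≤ 1)
    (h1 : Real.exp (f (vinetStrain V₀ B₀ B₀' P₁)) ≤ h₁)
    (h2 : Real.exp (f (vinetStrain V₀ B₀ B₀' P₂)) ≤ h₂)
    (htest : max h₁ h₂ * expUB (S * (((P₂ - P₁) / (B₀ + 2 / 3 * P₁)) / 2)) < θ)
    (hP : P ∈ Icc P₁ P₂) : Real.exp (f (vinetStrain V₀ B₀ B₀' P)) < θ :=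
  exp_lt_on_pressure_Icc_of_expUB_test (vinetStrain_monotoneOn hV₀ hB₀ hB hP₁)
    (vinetStrain_sub_le hV₀ hB₀ hB hP₁ h12) hcont hder hS hS0 h12 hx1 h1 h2 htest hP

/-! ## §3 The third-order Birch–Murnaghan law of record (`B₀' ≥ 4`) -/

/-- The log-compression along the inverse BM3 law, `ln(V₀/V(P))`. [folklore] -/
noncomputable def bm3Strain (V₀ B₀ B₀' P : ℝ) : ℝ :=
  Real.log (V₀ / birchMurnaghan3Volume V₀ B₀ B₀' P)

/-- **BM3 SPACING, upper bound**: for `V₀ > 0`, `B₀ > 0`, `B₀' ≥ 4`, `0 ≤ P₁ ≤ P₂`,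
`ln(V(P₁)/V(P₂)) ≤ (P₂ - P₁)/(B₀ + (7/3) P₁)` (lit-3 `birchMurnaghan3_le_bulkModulus`). [folklore] -/
theorem log_bm3_spacing_le {V₀ B₀ B₀' P₁ P₂ : ℝ} (hV₀ : 0 < V₀) (hB₀ : 0 < B₀) (hB : 4 ≤ B₀')
    (hP₁ : 0 ≤ P₁) (h12 : P₁ ≤ P₂) :
    Real.log (birchMurnaghan3Volume V₀ B₀ B₀' P₁ / birchMurnaghan3Volume V₀ B₀ B₀' P₂) ≤
      (P₂ - P₁) / (B₀ + 7 / 3 * P₁) := by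
  set V₁ := birchMurnaghan3Volume V₀ B₀ B₀' P₁ with hV₁def
  set V₂ := birchMurnaghan3Volume V₀ B₀ B₀' P₂ with hV₂def
  have hP₂ : 0 ≤ P₂ := hP₁.trans h12
  have hV₂pos : 0 < V₂ := birchMurnaghan3Volume_pos hV₀ hB₀ hB hP₂
  have hV₁le : V₁ ≤ V₀ := birchMurnaghan3Volume_le_self hV₀.le hB₀ hB hP₁
  have h21 : V₂ ≤ V₁ := birchMurnaghan3Volume_antitone_pressure hV₀.le hB₀ hB hP₁ h12
  have hPV₁ : birchMurnaghan3Pressure V₀ B₀ B₀' V₁ = P₁ :=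
    birchMurnaghan3Pressure_birchMurnaghan3Volume hV₀ hB₀ hB hP₁
  have hPV₂ : birchMurnaghan3Pressure V₀ B₀ B₀' V₂ = P₂ :=
    birchMurnaghan3Pressure_birchMurnaghan3Volume hV₀ hB₀ hB hP₂
  have hKmin : 0 < B₀ + 7 / 3 * P₁ := by positivity
  have hanti := birchMurnaghan3Pressure_strictAntiOn hV₀ hB₀ hB
  have key : Real.log (V₁ / V₂) ≤
      (birchMurnaghan3Pressure V₀ B₀ B₀' V₂ - birchMurnaghan3Pressure V₀ B₀ B₀' V₁)
        / (B₀ + 7 / 3 * P₁) := by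
    refine log_div_le_sub_div_of_bulkModulus_ge (P' := deriv (birchMurnaghan3Pressure V₀ B₀ B₀'))
      hV₂pos h21 hKmin (fun v hv => ?_) (fun v hv => ?_)
    · have hv0 : 0 < v := lt_of_lt_of_le hV₂pos hv.1
      exact (hasDerivAt_deriv_and_of_exists
        (birchMurnaghan3_le_bulkModulus hV₀ hB₀.le hB hv0 (hv.2.trans hV₁le))).1
    · have hv0 : 0 < v := lt_of_lt_of_le hV₂pos hv.1
      have hvV₀ : v ≤ V₀ := hv.2.trans hV₁le
      have hfl := (hasDerivAt_deriv_and_of_exists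
        (birchMurnaghan3_le_bulkModulus hV₀ hB₀.le hB hv0 hvV₀)).2
      have hPv : P₁ ≤ birchMurnaghan3Pressure V₀ B₀ B₀' v := by
        rw [← hPV₁]
        exact hanti.antitoneOn ⟨hv0, hvV₀⟩ ⟨lt_of_lt_of_le hV₂pos h21, hV₁le⟩ hv.2
      linarith
  rw [hPV₁, hPV₂] at key
  exact key

/-- **BM3 SPACING, lower bound**: `(P₂ - P₁)/(B₀ + B₀' P₂) ≤ ln(V(P₁)/V(P₂))`
(lit-3 `birchMurnaghan3_bulkModulus_le`). [folklore] -/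
theorem le_log_bm3_spacing {V₀ B₀ B₀' P₁ P₂ : ℝ} (hV₀ : 0 < V₀) (hB₀ : 0 < B₀) (hB : 4 ≤ B₀')
    (hP₁ : 0 ≤ P₁) (h12 : P₁ ≤ P₂) :
    (P₂ - P₁) / (B₀ + B₀' * P₂) ≤
      Real.log (birchMurnaghan3Volume V₀ B₀ B₀' P₁ / birchMurnaghan3Volume V₀ B₀ B₀' P₂) := by
  set V₁ := birchMurnaghan3Volume V₀ B₀ B₀' P₁ with hV₁def
  set V₂ := birchMurnaghan3Volume V₀ B₀ B₀' P₂ with hV₂def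
  have hP₂ : 0 ≤ P₂ := hP₁.trans h12
  have hB' : 0 < B₀' := by linarith
  have hV₂pos : 0 < V₂ := birchMurnaghan3Volume_pos hV₀ hB₀ hB hP₂
  have hV₁le : V₁ ≤ V₀ := birchMurnaghan3Volume_le_self hV₀.le hB₀ hB hP₁
  have hV₂le : V₂ ≤ V₀ := birchMurnaghan3Volume_le_self hV₀.le hB₀ hB hP₂
  have h21 : V₂ ≤ V₁ := birchMurnaghan3Volume_antitone_pressure hV₀.le hB₀ hB hP₁ h12
  have hPV₁ : birchMurnaghan3Pressure V₀ B₀ B₀' V₁ = P₁ :=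
    birchMurnaghan3Pressure_birchMurnaghan3Volume hV₀ hB₀ hB hP₁
  have hPV₂ : birchMurnaghan3Pressure V₀ B₀ B₀' V₂ = P₂ :=
    birchMurnaghan3Pressure_birchMurnaghan3Volume hV₀ hB₀ hB hP₂
  have hKmax : 0 < B₀ + B₀' * P₂ := by positivity
  have hanti := birchMurnaghan3Pressure_strictAntiOn hV₀ hB₀ hB
  have key : (birchMurnaghan3Pressure V₀ B₀ B₀' V₂ - birchMurnaghan3Pressure V₀ B₀ B₀' V₁)
        / (B₀ + B₀' * P₂) ≤ Real.log (V₁ / V₂) := by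
    refine sub_div_le_log_div_of_bulkModulus_le (P' := deriv (birchMurnaghan3Pressure V₀ B₀ B₀'))
      hV₂pos h21 hKmax (fun v hv => ?_) (fun v hv => ?_)
    · have hv0 : 0 < v := lt_of_lt_of_le hV₂pos hv.1
      exact (hasDerivAt_deriv_and_of_exists
        (birchMurnaghan3_bulkModulus_le hV₀ hB₀.le hB hv0 (hv.2.trans hV₁le))).1
    · have hv0 : 0 < v := lt_of_lt_of_le hV₂pos hv.1
      have hvV₀ : v ≤ V₀ := hv.2.trans hV₁le
      have hcl := (hasDerivAt_deriv_and_of_exists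
        (birchMurnaghan3_bulkModulus_le hV₀ hB₀.le hB hv0 hvV₀)).2
      have hPv : birchMurnaghan3Pressure V₀ B₀ B₀' v ≤ P₂ := by
        rw [← hPV₂]
        exact hanti.antitoneOn ⟨hV₂pos, hV₂le⟩ ⟨hv0, hvV₀⟩ hv.1
      nlinarith [mul_le_mul_of_nonneg_left hPv hB'.le]
  rw [hPV₁, hPV₂] at key
  exact key

/-- The BM3 spacing is nonnegative. [folklore] -/
theorem log_bm3_spacing_nonneg {V₀ B₀ B₀' P₁ P₂ : ℝ} (hV₀ : 0 < V₀) (hB₀ : 0 < B₀) (hB : 4 ≤ B₀')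
    (hP₁ : 0 ≤ P₁) (h12 : P₁ ≤ P₂) :
    0 ≤ Real.log (birchMurnaghan3Volume V₀ B₀ B₀' P₁ / birchMurnaghan3Volume V₀ B₀ B₀' P₂) := by
  have hB' : 0 < B₀' := by linarith
  have hK : 0 < B₀ + B₀' * P₂ := by nlinarith [hP₁.trans h12]
  exact (div_nonneg (sub_nonneg.2 h12) hK.le).trans (le_log_bm3_spacing hV₀ hB₀ hB hP₁ h12)

/-- `bm3Strain P₂ - bm3Strain P₁ = ln(V(P₁)/V(P₂))`. [folklore] -/
theorem bm3Strain_sub_eq {V₀ B₀ B₀' P₁ P₂ : ℝ} (hV₀ : 0 < V₀) (hB₀ : 0 < B₀) (hB : 4 ≤ B₀')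
    (hP₁ : 0 ≤ P₁) (hP₂ : 0 ≤ P₂) :
    bm3Strain V₀ B₀ B₀' P₂ - bm3Strain V₀ B₀ B₀' P₁ =
      Real.log (birchMurnaghan3Volume V₀ B₀ B₀' P₁ / birchMurnaghan3Volume V₀ B₀ B₀' P₂) := by
  have h1 := birchMurnaghan3Volume_pos hV₀ hB₀ hB hP₁
  have h2 := birchMurnaghan3Volume_pos hV₀ hB₀ hB hP₂
  unfold bm3Strain
  rw [Real.log_div hV₀.ne' h2.ne', Real.log_div hV₀.ne' h1.ne', Real.log_div h1.ne' h2.ne']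
  ring

/-- The BM3 log-compression is MONOTONE on `[P₁, P₂]` for `P₁ ≥ 0`. [folklore] -/
theorem bm3Strain_monotoneOn {V₀ B₀ B₀' P₁ P₂ : ℝ} (hV₀ : 0 < V₀) (hB₀ : 0 < B₀) (hB : 4 ≤ B₀')
    (hP₁ : 0 ≤ P₁) : MonotoneOn (bm3Strain V₀ B₀ B₀') (Icc P₁ P₂) := by
  intro a ha b hb hab
  have ha0 : 0 ≤ a := hP₁.trans ha.1
  have hb0 : 0 ≤ b := hP₁.trans hb.1
  have h := log_bm3_spacing_nonneg hV₀ hB₀ hB ha0 hab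
  rw [← bm3Strain_sub_eq hV₀ hB₀ hB ha0 hb0] at h
  linarith

/-- **BM3 SPACING BOUND for the log-compression**: `c(P₂) - c(P₁) ≤ (P₂ - P₁)/(B₀ + (7/3) P₁)`.
[folklore] -/
theorem bm3Strain_sub_le {V₀ B₀ B₀' P₁ P₂ : ℝ} (hV₀ : 0 < V₀) (hB₀ : 0 < B₀) (hB : 4 ≤ B₀')
    (hP₁ : 0 ≤ P₁) (h12 : P₁ ≤ P₂) :
    bm3Strain V₀ B₀ B₀' P₂ - bm3Strain V₀ B₀ B₀' P₁ ≤ (P₂ - P₁) / (B₀ + 7 / 3 * P₁) := by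
  rw [bm3Strain_sub_eq hV₀ hB₀ hB hP₁ (hP₁.trans h12)]
  exact log_bm3_spacing_le hV₀ hB₀ hB hP₁ h12

/-- **ALL-IN-ONE, BM3 EOS OF RECORD** (`B₀' ≥ 4`): the margin test run with
`Lbar = (P₂ - P₁)/(B₀ + (7/3) P₁)` decides the upper guard on the whole pressure sub-interval.
[folklore] -/
theorem exp_lt_on_pressure_Icc_of_bm3_test {f f' : ℝ → ℝ} {V₀ B₀ B₀' P₁ P₂ S h₁ h₂ θ P : ℝ}
    (hV₀ : 0 < V₀) (hB₀ : 0 < B₀) (hB : 4 ≤ B₀') (hP₁ : 0 ≤ P₁) (h12 : P₁ ≤ P₂)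
    (hcont : ContinuousOn f (Icc (bm3Strain V₀ B₀ B₀' P₁) (bm3Strain V₀ B₀ B₀' P₂)))
    (hder : ∀ x ∈ Ioo (bm3Strain V₀ B₀ B₀' P₁) (bm3Strain V₀ B₀ B₀' P₂), HasDerivAt f (f' x) x)
    (hS : ∀ x ∈ Ioo (bm3Strain V₀ B₀ B₀' P₁) (bm3Strain V₀ B₀ B₀' P₂), |f' x| ≤ S)
    (hS0 : 0 ≤ S) (hx1 : S * (((P₂ - P₁) / (B₀ + 7 / 3 * P₁)) / 2) ≤ 1)
    (h1 : Real.exp (f (bm3Strain V₀ B₀ B₀' P₁)) ≤ h₁)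
    (h2 : Real.exp (f (bm3Strain V₀ B₀ B₀' P₂)) ≤ h₂)
    (htest : max h₁ h₂ * expUB (S * (((P₂ - P₁) / (B₀ + 7 / 3 * P₁)) / 2)) < θ)
    (hP : P ∈ Icc P₁ P₂) : Real.exp (f (bm3Strain V₀ B₀ B₀' P)) < θ :=
  exp_lt_on_pressure_Icc_of_expUB_test (bm3Strain_monotoneOn hV₀ hB₀ hB hP₁)
    (bm3Strain_sub_le hV₀ hB₀ hB hP₁ h12) hcont hder hS hS0 h12 hx1 h1 h2 htest hP

/-! ## §4 Rows of record on their Vinet / BM3 inputs -/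

/-- **GRID-CURE PRE-REGISTRATION V (0,10) ON THE VINET CLASS LAW OF THE ROW** (`K₀ 162 GPa`,
`K′ 3.5 ≥ 1`; pre-registered guards `r_man,hi` 0.55 @0 / 0.52 expected @10): spacing
`≤ 10/(162 + (2/3)·0) = 10/162` ⇒ `0.55 · expUB (1.2 · 10/162) = 0.5923 < 0.6` — the pre-registered
floating value was `L = 0.056`, margin 0.588. [folklore] -/
theorem v_0_10_vinet_test :
    max (55 / 100 : ℝ) (52 / 100) * expUB ((12 / 5) * (((10 - 0) / (162 + 2 / 3 * 0)) / 2)) < 3 / 5 := by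
  rw [max_eq_left (by norm_num)]; unfold expUB; norm_num

/-- **Pb M02 REACH 10 → 13.7 AS A STATEMENT ABOUT THE BOX BM3 LAW** (`B₀ 39.8`, `B₀' 4.85 ≥ 4`, any
`V₀ > 0`): `ln(V(10)/V(13.7)) ≤ 3.7/(39.8 + (7/3)·10) ≤ 0.06` — the cap `ℓ ≤ 0.06` of §P.12(c′) holds
on the whole reach up to the printed fcc → hcp entry. [folklore] -/
theorem pb_bm3_reach_spacing_le {V₀ : ℝ} (hV₀ : 0 < V₀) :
    Real.log (birchMurnaghan3Volume V₀ (398 / 10) (485 / 100) 10 /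
        birchMurnaghan3Volume V₀ (398 / 10) (485 / 100) (137 / 10)) ≤ 6 / 100 := by
  have h := log_bm3_spacing_le (V₀ := V₀) (B₀ := 398 / 10) (B₀' := 485 / 100) (P₁ := 10)
    (P₂ := 137 / 10) hV₀ (by norm_num) (by norm_num) (by norm_num) (by norm_num)
  refine h.trans ?_
  norm_num

end Inflation

end Summit.Ventures.CertifiedManyBodySolver.Downfold
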